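/-
Copyright (c) 2026 the pub-hodgecm-mathlib formalisation cell (harness21).  Prover seat hodgecm-mathlib-K2E5-p01 (g4) (free E5 hand, cross-unit), HCML Track B «K2-LIT»,
h413 = `stmt-HodgeConjecture-24833`, line `K2_E3_EllipticInputs`, unit U12, socket #11 road (SC-an), residual road «HC-14-ell» (opened by K2E3-plan (g2) (R-ell)
2026-09-04T03:06Z; (SC-an) line lead K2E3-p14 (g3) MAP v4 «E5 → K2E5-p01 (g4)»), brick E5 «TRANSPORT», FILE A «translated Cayley windows».  2026-09-04.
-/
import Summits.HodgeConjecture.HodgeConjecture.Theorems.K2E3CayleyTokenAlgebra                 -- ★ E5a p857026 (K2E4-p07): `coe_sqrt_sqrt_weylRatio_smul_cayley`, `coe_sqrt_sqrt_eq_rpow`; brings ★ `cayley_conj`, `inverseWindow_cayley`, `inverseWindow_conj`, `conj_add_one`, `normAbs`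
import Literature.NumberTheory.Weil1982.CayleyCentralShift                                     -- ★ `transpose_map_smul_mul_smul_of_unitary`, `isUnit_det_of_unitary`; brings ★ `cayley_inverseWindow`, `one_sub_inverseWindow`, `transpose_map_inverseWindow_add_eq_zero`
import Literature.NumberTheory.Automorphic.UnitaryGroupAutomorphicRep                           -- ★ `unitaryGroupOfForm`, `mem_unitaryGroupOfForm_iff`
import HarnessLib

/-!
# K2 · E3 · (SC-an) residual road «HC-14-ell», brick E5 «TRANSPORT», FILE A: TRANSLATED CAYLEY WINDOWS ON `U(σ, J)(K)` —
# infinitely many norm-one scalars, Ad-invariance of the Lie algebra, and on the window `O_z = {u | det(z⁻¹u + 1) ∈ Kˣ}` the skew parameter `X = ψ_z(u)`,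
# `u = z · c(X)`, the conjugation-invariant continuous chart factor `cc_z` and the token identity `T(u) = cc_z(u) · |discr χ_X|^{1∕4}`

Cell `pub/hodgecm-mathlib`, crux H413 = `stmt-HodgeConjecture-24833` (lane `--supports … --as helper`, count-neutral); (SC-an) line lead K2E3-p14 (g3), dealer K2E3-plan (g2).
THEOREMS ONLY (no `def` ∕ `instance` ∕ `notation` ∕ named fact ∕ `sorry`); ★-only imports.  FILE B `K2E3HC14EllOfHC13Lie` assembles these into
`sig_K2E3HC13LieEllRankOne ⟹ sig_K2E3HC14EllRankOne` (Harish-Chandra's Theorem 14 for the compact Cartans of `U(σ, Φ₃)(K)` from his Theorem 13 on `𝔲(σ, Φ₃)(K)`).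

THE MATHEMATICS ([PlatonovRapinchuk1994 §3.3], [Rogawski1990 §7.3], [HarishChandra1970 VI §8]).  The Cayley map `c(X) = (1 + X)(1 − X)⁻¹` parametrises the unitary `u` with
`det(u + 1) ≠ 0` by skew `X`; translating by the norm-one scalars `z` (`σ z · z = 1`) — of which there are INFINITELY many as soon as `σ ≠ id` is an involution and
`char K = 0` (§1: `z_n = (n + w)∕(n − w)`, `σ w = −w`) — the windows `O_z` cover `U` (a unitary `3 × 3` matrix has at most three eigenvalues, ★
`exists_mem_isUnit_det_add_smul_one`).  On `O_z`: `X = ψ_z(u) := (z⁻¹u − 1)(z⁻¹u + 1)⁻¹` is skew with `det(1 ∓ X)` units and `u = z · c(X)` (★ `cayley_inverseWindow`, ★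
`transpose_map_inverseWindow_add_eq_zero` — the deterministic twin of ★ `exists_central_shift`), and ★ E5a `coe_sqrt_sqrt_weylRatio_smul_cayley` reads the (SC-an) group token as
`T(u) = cc_z(u) · |discr χ_X|^{1∕4}` with `cc_z(u) = (|2|⁶ ∕ |det(1 − X) det(1 + X)|²)^{1∕4}`, CONTINUOUS on `O_z` and CONJUGATION-INVARIANT (★ `inverseWindow_conj`).
* §1 `setOf_mul_self_eq_one_infinite`, `conj_skew` (any size `n`), `continuousOn_inverseWindow`, `continuousOn_cayley_window`.
* §2 (`3 × 3`) `isOpen_window`, `window_data`, `continuousOn_psi`, `cc_conj`, `continuousOn_cc`, `token_eq_cc_mul`.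

HONEST LABEL: HC_CM is proved only modulo the 7 printed citations (2 remaining named inputs: hLiu418 = `stmt-HodgeConjecture-24832`, h413 = `stmt-HodgeConjecture-24833`)
until rung 0 closes; count-neutral helper (E5 FILE A of road HC-14-ell; (SC-an) is NOT ★).

## References
* [PlatonovRapinchuk1994] V. Platonov, A. Rapinchuk, *Algebraic Groups and Number Theory* (1994), §3.3 (Cayley parametrisation of unitary groups).
* [Rogawski1990] J. D. Rogawski, *Automorphic Representations of Unitary Groups in Three Variables* (1990), §7.3 p. 97.
* [HarishChandra1970] Harish-Chandra (notes by G. van Dijk), *Harmonic Analysis on Reductive p-adic Groups*, LNM 162 (1970), Part VI §8 Theorem 14 p. 60.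
-/

set_option autoImplicit false
-- the mandated namespace has the single-problem summit's repeated segment (`HodgeConjecture.HodgeConjecture`)
set_option linter.dupNamespace false

noncomputable section

open MeasureTheory Measure Set Filter Topology
open scoped NNReal ENNReal MatrixGroups WithZero Matrix
open Literature.NumberTheory.Automorphic Literature.NumberTheory.Automorphic.UnitaryGroup Literature.NumberTheory.Rogawski1990
open Literature.NumberTheory.GaloisRepresentations Literature.NumberTheory.GaloisRepresentations.IsNonarchimedeanLocalField
open Literature.NumberTheory.Weil1982.UnitaryFinTopForm Literature.LinearAlgebra.Matrix
open Summit.HodgeConjecture.HodgeConjecture.Cruxes.H413.K2E3CayleyScalingAlgebra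
open Summit.HodgeConjecture.HodgeConjecture.Cruxes.H413.K2E3CayleyTokenAlgebra

namespace Summit.HodgeConjecture.HodgeConjecture.Cruxes.H413.K2E3HC14EllCayleyWindows

/-! ## §1 Generic helpers: infinitely many norm-one scalars, Ad-invariance of `𝔲`, continuity of the inverse window -/

section NormOne

variable {K : Type*} [Field K] [CharZero K] (σ : K →+* K)

/-- **The norm-one scalars `{z | σ z · z = 1}` are INFINITE** for an involution `σ ≠ id` of a field of characteristic zero: with `w := x − σ x ≠ 0` (`σ w = −w`) the
elements `z_n := (n + w) ∕ (n − w)`, `n ∈ ℕ`, are pairwise distinct norm-one scalars (`z_n = z_m ⇒ 2(m − n)w = 0`).  This is the `hE` binder of every ★ Cayley-window file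
(★ `exists_central_shift`, ★ (ε5), ★ F-D6), discharged from the letter's frame `hσ`, `hσ1`. [cite: PlatonovRapinchuk1994, §3.3] -/
theorem setOf_mul_self_eq_one_infinite (hσ : ∀ x, σ (σ x) = x) (hσ1 : ∃ x : K, σ x ≠ x) : {z : K | σ z * z = 1}.Infinite := by
  obtain ⟨x, hx⟩ := hσ1
  set w : K := x - σ x with hw
  have hσw : σ w = -w := by rw [hw, map_sub, hσ, neg_sub]
  have hw0 : w ≠ 0 := fun h => hx (sub_eq_zero.1 (by rw [← hw, h])).symm
  -- `n ± w ≠ 0`: otherwise `w = ∓n` would be `σ`-fixed, i.e. `w = -w`, `w = 0`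
  have hfix : ∀ c : K, σ c = c → c + w ≠ 0 := by
    intro c hc h
    have h1 : w = -c := eq_neg_of_add_eq_zero_right h
    have h2 : σ w = w := by rw [h1, map_neg, hc]
    rw [hσw] at h2
    exact hw0 (by linear_combination (-(1:K)/2) * h2)
  have hden : ∀ n : ℕ, (n : K) - w ≠ 0 := by
    intro n h
    have := hfix (-(n : K)) (by rw [map_neg, map_natCast])
    apply this
    linear_combination (-1 : K) * h
  have hnum : ∀ n : ℕ, (n : K) + w ≠ 0 := fun n => hfix n (map_natCast σ n)
  -- the family
  let z : ℕ → K := fun n => ((n : K) + w) / ((n : K) - w)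
  have hzmem : ∀ n, σ (z n) * z n = 1 := by
    intro n
    have hσn : σ ((n : K) + w) = (n : K) - w := by rw [map_add, map_natCast, hσw]; ring
    have hσd : σ ((n : K) - w) = (n : K) + w := by rw [map_sub, map_natCast, hσw]; ring
    simp only [z, map_div₀, hσn, hσd]
    rw [div_mul_div_comm, mul_comm ((n : K) - w), div_self (mul_ne_zero (hnum n) (hden n))]
  have hzinj : Function.Injective z := by
    intro m n hmn
    simp only [z] at hmn
    rw [div_eq_div_iff (hden m) (hden n)] at hmn
    have h2 : (2 : K) * (((m : K)) - (n : K)) * w = 0 := by linear_combination (-1 : K) * hmn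
    have hmn' : (m : K) - (n : K) = 0 := by
      rcases mul_eq_zero.1 h2 with h | h
      · rcases mul_eq_zero.1 h with h' | h'
        · exact absurd h' two_ne_zero
        · exact h'
      · exact absurd h hw0
    exact_mod_cast sub_eq_zero.1 hmn'
  exact Set.infinite_of_injective_forall_mem hzinj hzmem

end NormOne

section Skew

variable {R : Type*} [CommRing R] {n : Type*} [Fintype n] [DecidableEq n] (σ : R →+* R)

/-- **Ad `U` PRESERVES THE LIE ALGEBRA** (any size): for `u ∈ U(σ, J′)` and `Y` skew (`ᵗ(σY)·J′ + J′·Y = 0`), `u Y u⁻¹` is skew (`J′ u⁻¹ = ᵗ(σu) J′`, `ᵗ(σ u⁻¹) J′ = J′ u`; the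
`n × n` twin of K2E5-p15 (g3)'s ★ `conj_mem_lie`). [cite: PlatonovRapinchuk1994, §3.3] -/
theorem conj_skew (J' : Matrix n n R) (u : ↥(unitaryGroupOfForm σ J')) {Y : Matrix n n R} (hY : (Y.map σ)ᵀ * J' + J' * Y = 0) :
    ((((u : GL n R) : Matrix n n R) * Y * (((u : GL n R)⁻¹ : GL n R) : Matrix n n R)).map σ)ᵀ * J' +
      J' * (((u : GL n R) : Matrix n n R) * Y * (((u : GL n R)⁻¹ : GL n R) : Matrix n n R)) = 0 := by
  have hu : (((u : GL n R) : Matrix n n R).map σ)ᵀ * J' * (u : GL n R) = J' := mem_unitaryGroupOfForm_iff.1 u.2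
  have hui : ((((u : GL n R)⁻¹ : GL n R) : Matrix n n R).map σ)ᵀ * J' * (((u : GL n R)⁻¹ : GL n R) : Matrix n n R) = J' := by
    have := mem_unitaryGroupOfForm_iff.1 (u⁻¹).2
    rwa [Subgroup.coe_inv] at this
  have hinv : ((u : GL n R) : Matrix n n R) * (((u : GL n R)⁻¹ : GL n R) : Matrix n n R) = 1 := by
    rw [← Units.val_mul, mul_inv_cancel, Units.val_one]
  have hinv' : (((u : GL n R)⁻¹ : GL n R) : Matrix n n R) * ((u : GL n R) : Matrix n n R) = 1 := by
    rw [← Units.val_mul, inv_mul_cancel, Units.val_one]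
  -- `J' u = ᵗ(σ u⁻¹) J'` and `ᵗ(σ u) J' = J' u⁻¹`
  have h1 : J' * ((u : GL n R) : Matrix n n R) = ((((u : GL n R)⁻¹ : GL n R) : Matrix n n R).map σ)ᵀ * J' := by
    calc J' * ((u : GL n R) : Matrix n n R)
        = ((((u : GL n R)⁻¹ : GL n R) : Matrix n n R).map σ)ᵀ * J' * ((((u : GL n R)⁻¹ : GL n R) : Matrix n n R) * ((u : GL n R) : Matrix n n R)) := by
          rw [← Matrix.mul_assoc, hui]
      _ = ((((u : GL n R)⁻¹ : GL n R) : Matrix n n R).map σ)ᵀ * J' := by rw [hinv', Matrix.mul_one]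
  have h2 : (((u : GL n R) : Matrix n n R).map σ)ᵀ * J' = J' * (((u : GL n R)⁻¹ : GL n R) : Matrix n n R) := by
    calc (((u : GL n R) : Matrix n n R).map σ)ᵀ * J'
        = (((u : GL n R) : Matrix n n R).map σ)ᵀ * J' * (((u : GL n R) : Matrix n n R) * (((u : GL n R)⁻¹ : GL n R) : Matrix n n R)) := by
          rw [hinv, Matrix.mul_one]
      _ = J' * (((u : GL n R)⁻¹ : GL n R) : Matrix n n R) := by rw [← Matrix.mul_assoc, hu]
  have hYJ : (Y.map σ)ᵀ * J' = -(J' * Y) := eq_neg_of_add_eq_zero_left hY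
  rw [Matrix.map_mul, Matrix.map_mul, Matrix.transpose_mul, Matrix.transpose_mul]
  calc ((((u : GL n R)⁻¹ : GL n R) : Matrix n n R).map σ)ᵀ * ((Y.map σ)ᵀ * (((u : GL n R) : Matrix n n R).map σ)ᵀ) * J' +
        J' * (((u : GL n R) : Matrix n n R) * Y * (((u : GL n R)⁻¹ : GL n R) : Matrix n n R))
      = ((((u : GL n R)⁻¹ : GL n R) : Matrix n n R).map σ)ᵀ * (Y.map σ)ᵀ * ((((u : GL n R) : Matrix n n R).map σ)ᵀ * J') +
          J' * ((u : GL n R) : Matrix n n R) * Y * (((u : GL n R)⁻¹ : GL n R) : Matrix n n R) := by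
        simp only [Matrix.mul_assoc]
    _ = ((((u : GL n R)⁻¹ : GL n R) : Matrix n n R).map σ)ᵀ * ((Y.map σ)ᵀ * J') * (((u : GL n R)⁻¹ : GL n R) : Matrix n n R) +
          J' * ((u : GL n R) : Matrix n n R) * Y * (((u : GL n R)⁻¹ : GL n R) : Matrix n n R) := by
        rw [h2]; simp only [Matrix.mul_assoc]
    _ = 0 := by rw [hYJ, h1]; simp only [Matrix.mul_neg, Matrix.neg_mul, Matrix.mul_assoc, neg_add_cancel]

end Skew

section Window

variable {K : Type*} [Field K] [ValuativeRel K] [TopologicalSpace K] [IsNonarchimedeanLocalField K] {n : Type*} [Fintype n] [DecidableEq n]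

/-- **The inverse Cayley window `A ↦ (A − 1)(A + 1)⁻¹` is continuous on `{A | det(A + 1) ∈ Kˣ}`** (matrix inversion is continuous at invertible matrices, Mathlib
`continuousAt_matrix_inv`). [cite: PlatonovRapinchuk1994, §3.3] -/
theorem continuousOn_inverseWindow :
    ContinuousOn (fun A : Matrix n n K => (A - 1) * (A + 1)⁻¹) {A : Matrix n n K | IsUnit (A + 1).det} := by
  haveI : T2Space K := (IsNonarchimedeanLocalField.isLocalField K).toT2Space
  intro A hA
  refine ContinuousAt.continuousWithinAt ?_
  have hinv : ContinuousAt Ring.inverse (A + 1).det := by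
    rw [Ring.inverse_eq_inv']
    exact continuousAt_inv₀ hA.ne_zero
  have h1 : ContinuousAt (fun B : Matrix n n K => B⁻¹) (A + 1) := continuousAt_matrix_inv (A + 1) hinv
  have h2 : ContinuousAt (fun B : Matrix n n K => (B + 1)⁻¹) A :=
    ContinuousAt.comp (g := fun B : Matrix n n K => B⁻¹) h1 (continuousAt_id.add continuousAt_const)
  exact (continuousAt_id.sub continuousAt_const).mul h2

/-- **The Cayley window `Y ↦ c(Y) = (1 + Y)(1 − Y)⁻¹` is continuous on `{Y | det(1 − Y) ∈ Kˣ}`.** [cite: PlatonovRapinchuk1994, §3.3] -/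
theorem continuousOn_cayley_window :
    ContinuousOn (fun Y : Matrix n n K => cayley Y) {Y : Matrix n n K | IsUnit (1 - Y).det} := by
  haveI : T2Space K := (IsNonarchimedeanLocalField.isLocalField K).toT2Space
  intro Y hY
  refine ContinuousAt.continuousWithinAt ?_
  have hinv : ContinuousAt Ring.inverse (1 - Y).det := by
    rw [Ring.inverse_eq_inv']
    exact continuousAt_inv₀ hY.ne_zero
  have h1 : ContinuousAt (fun B : Matrix n n K => B⁻¹) (1 - Y) := continuousAt_matrix_inv (1 - Y) hinv
  have h2 : ContinuousAt (fun B : Matrix n n K => (1 - B)⁻¹) Y :=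
    ContinuousAt.comp (g := fun B : Matrix n n K => B⁻¹) h1 (continuousAt_const.sub continuousAt_id)
  simp only [cayley_def]
  exact (continuousAt_const.add continuousAt_id).mul h2

end Window

/-! ## §2 The translated Cayley window at a norm-one scalar `z` on `U = U(σ, J)(K)` (`3 × 3`) -/

section TranslatedWindow

variable {K : Type*} [Field K] [ValuativeRel K] [TopologicalSpace K] [IsNonarchimedeanLocalField K]
  (σ : K →+* K) {J : Matrix (Fin 3) (Fin 3) K}

/-- **The window `O_z = {u ∈ U | det(z⁻¹u + 1) ∈ Kˣ}` is open** (`det` is continuous, `Kˣ = K ∖ {0}` is open). [cite: PlatonovRapinchuk1994, §3.3] -/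
theorem isOpen_window (z : K) :
    IsOpen {u : ↥(unitaryGroupOfForm σ J) | IsUnit (z⁻¹ • ((u : GL (Fin 3) K) : Matrix (Fin 3) (Fin 3) K) + 1).det} := by
  haveI : T2Space K := (IsNonarchimedeanLocalField.isLocalField K).toT2Space
  have hc : Continuous fun u : ↥(unitaryGroupOfForm σ J) => (z⁻¹ • ((u : GL (Fin 3) K) : Matrix (Fin 3) (Fin 3) K) + 1).det :=
    (((Units.continuous_val.comp continuous_subtype_val).const_smul z⁻¹).add continuous_const).matrix_det
  have hset : {u : ↥(unitaryGroupOfForm σ J) | IsUnit (z⁻¹ • ((u : GL (Fin 3) K) : Matrix (Fin 3) (Fin 3) K) + 1).det} =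
      (fun u : ↥(unitaryGroupOfForm σ J) => (z⁻¹ • ((u : GL (Fin 3) K) : Matrix (Fin 3) (Fin 3) K) + 1).det) ⁻¹' {0}ᶜ := by
    ext u; simp only [Set.mem_setOf_eq, Set.mem_preimage, Set.mem_compl_iff, Set.mem_singleton_iff, isUnit_iff_ne_zero]
  rw [hset]
  exact isOpen_compl_singleton.preimage hc

omit [ValuativeRel K] [TopologicalSpace K] [IsNonarchimedeanLocalField K] in
/-- **WINDOW DATA.**  For `u ∈ O_z` (`σ z · z = 1`, `2 ≠ 0`, `J` invertible) and `X := (z⁻¹u − 1)(z⁻¹u + 1)⁻¹`: `X` is SKEW, `det(1 − X)`, `det(1 + X)` are units, and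
`u = z · c(X)` — the deterministic twin of ★ `exists_central_shift` at a GIVEN `z` (★ `cayley_inverseWindow`, ★ `one_sub_inverseWindow`, ★ `transpose_map_inverseWindow_add_eq_zero`).
[cite: PlatonovRapinchuk1994, §3.3] -/
theorem window_data (h2 : (2 : K) ≠ 0) (hJ : IsUnit J.det) {z : K} (hz1 : σ z * z = 1) (u : ↥(unitaryGroupOfForm σ J))
    (hu : IsUnit (z⁻¹ • ((u : GL (Fin 3) K) : Matrix (Fin 3) (Fin 3) K) + 1).det) :
    (((z⁻¹ • ((u : GL (Fin 3) K) : Matrix (Fin 3) (Fin 3) K) - 1) * (z⁻¹ • ((u : GL (Fin 3) K) : Matrix (Fin 3) (Fin 3) K) + 1)⁻¹).map σ)ᵀ * J + J * ((z⁻¹ • ((u : GL (Fin 3) K) : Matrix (Fin 3) (Fin 3) K) - 1) * (z⁻¹ • ((u : GL (Fin 3) K) : Matrix (Fin 3) (Fin 3) K) + 1)⁻¹) = 0 ∧ IsUnit (1 - ((z⁻¹ • ((u : GL (Fin 3) K) : Matrix (Fin 3) (Fin 3) K) - 1) * (z⁻¹ • ((u : GL (Fin 3) K) : Matrix (Fin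 3) (Fin 3) K) + 1)⁻¹)).det ∧ IsUnit (1 + ((z⁻¹ • ((u : GL (Fin 3) K) : Matrix (Fin 3) (Fin 3) K) - 1) * (z⁻¹ • ((u : GL (Fin 3) K) : Matrix (Fin 3) (Fin 3) K) + 1)⁻¹)).det ∧
      ((u : GL (Fin 3) K) : Matrix (Fin 3) (Fin 3) K) = z • cayley ((z⁻¹ • ((u : GL (Fin 3) K) : Matrix (Fin 3) (Fin 3) K) - 1) * (z⁻¹ • ((u : GL (Fin 3) K) : Matrix (Fin 3) (Fin 3) K) + 1)⁻¹) := by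
  have hz0 : z ≠ 0 := by
    rintro rfl
    rw [mul_zero] at hz1
    exact zero_ne_one hz1
  have hzi : σ z⁻¹ * z⁻¹ = 1 := by rw [map_inv₀, ← mul_inv, hz1, inv_one]
  have hU : (((u : GL (Fin 3) K) : Matrix (Fin 3) (Fin 3) K).map σ)ᵀ * J * ((u : GL (Fin 3) K) : Matrix (Fin 3) (Fin 3) K) = J := mem_unitaryGroupOfForm_iff.1 u.2
  have hU' : ((z⁻¹ • ((u : GL (Fin 3) K) : Matrix (Fin 3) (Fin 3) K)).map σ)ᵀ * J * (z⁻¹ • ((u : GL (Fin 3) K) : Matrix (Fin 3) (Fin 3) K)) = J := transpose_map_smul_mul_smul_of_unitary σ hU hzi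
  have h2u : IsUnit (2 : K) := isUnit_iff_ne_zero.2 h2
  obtain ⟨hm, hcay⟩ := cayley_inverseWindow h2u hu
  obtain ⟨-, hplus⟩ := one_sub_inverseWindow hu
  have hdetW : IsUnit (z⁻¹ • ((u : GL (Fin 3) K) : Matrix (Fin 3) (Fin 3) K)).det := isUnit_det_of_unitary σ hU' hJ
  refine ⟨transpose_map_inverseWindow_add_eq_zero σ hU' hu, hm, ?_, ?_⟩
  · rw [hplus, Matrix.det_smul, Matrix.det_mul]
    exact (h2u.pow _).mul (hdetW.mul (Matrix.isUnit_nonsing_inv_det _ hu))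
  · rw [hcay, smul_smul, mul_inv_cancel₀ hz0, one_smul]

/-- **The inverse window `ψ_z(u) = (z⁻¹u − 1)(z⁻¹u + 1)⁻¹` is continuous on `O_z`.** [cite: PlatonovRapinchuk1994, §3.3] -/
theorem continuousOn_psi (z : K) :
    ContinuousOn (fun u : ↥(unitaryGroupOfForm σ J) => ((z⁻¹ • ((u : GL (Fin 3) K) : Matrix (Fin 3) (Fin 3) K) - 1) * (z⁻¹ • ((u : GL (Fin 3) K) : Matrix (Fin 3) (Fin 3) K) + 1)⁻¹))
      {u : ↥(unitaryGroupOfForm σ J) | IsUnit (z⁻¹ • ((u : GL (Fin 3) K) : Matrix (Fin 3) (Fin 3) K) + 1).det} :=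
  continuousOn_inverseWindow.comp (((Units.continuous_val.comp continuous_subtype_val).const_smul z⁻¹).continuousOn) fun _ hu => hu

/-- **The chart factor is CONJUGATION-INVARIANT**: `cc_z(x u x⁻¹) = cc_z(u)` (the inverse window is Ad-equivariant, ★ `inverseWindow_conj`; `det` is conjugation-invariant).
[cite: PlatonovRapinchuk1994, §3.3] -/
theorem cc_conj {z : K} (x u : ↥(unitaryGroupOfForm σ J)) (hu : IsUnit (z⁻¹ • ((u : GL (Fin 3) K) : Matrix (Fin 3) (Fin 3) K) + 1).det) :
    NNReal.sqrt (NNReal.sqrt ((normAbs K 2) ^ 6 / (normAbs K ((1 - ((z⁻¹ • (((x * u * x⁻¹ : ↥(unitaryGroupOfForm σ J)) : GL (Fin 3) K) : Matrix (Fin 3) (Fin 3) K) - 1) * (z⁻¹ • (((x * u * x⁻¹ : ↥(unitaryGroupOfForm σ J)) : GL (Fin 3) K) : Matrix (Fin 3) (Fin 3) K) + 1)⁻¹)).det * (1 + ((z⁻¹ • (((x * u * x⁻¹ : ↥(unitaryGroupOfForm σ J)) : GL (Fin 3) K) : Matrix (Fin 3) (Fin 3) K) - 1) * (z⁻¹ •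 (((x * u * x⁻¹ : ↥(unitaryGroupOfForm σ J)) : GL (Fin 3) K) : Matrix (Fin 3) (Fin 3) K) + 1)⁻¹)).det)) ^ 2)) =
      NNReal.sqrt (NNReal.sqrt ((normAbs K 2) ^ 6 / (normAbs K ((1 - ((z⁻¹ • ((u : GL (Fin 3) K) : Matrix (Fin 3) (Fin 3) K) - 1) * (z⁻¹ • ((u : GL (Fin 3) K) : Matrix (Fin 3) (Fin 3) K) + 1)⁻¹)).det * (1 + ((z⁻¹ • ((u : GL (Fin 3) K) : Matrix (Fin 3) (Fin 3) K) - 1) * (z⁻¹ • ((u : GL (Fin 3) K) : Matrix (Fin 3) (Fin 3) K) + 1)⁻¹)).det)) ^ 2)) := by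
  have hconj : z⁻¹ • (((x * u * x⁻¹ : ↥(unitaryGroupOfForm σ J)) : GL (Fin 3) K) : Matrix (Fin 3) (Fin 3) K) =
      ((x : GL (Fin 3) K) : Matrix (Fin 3) (Fin 3) K) * (z⁻¹ • ((u : GL (Fin 3) K) : Matrix (Fin 3) (Fin 3) K)) * (((x : GL (Fin 3) K)⁻¹ : GL (Fin 3) K) : Matrix (Fin 3) (Fin 3) K) := by
    rw [Subgroup.coe_mul, Subgroup.coe_mul, Subgroup.coe_inv, Units.val_mul, Units.val_mul, Matrix.mul_smul, Matrix.smul_mul]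
  rw [hconj, inverseWindow_conj (x : GL (Fin 3) K) hu]
  obtain ⟨-, -, hadd, hsub⟩ := conj_add_one (x : GL (Fin 3) K) ((z⁻¹ • ((u : GL (Fin 3) K) : Matrix (Fin 3) (Fin 3) K) - 1) * (z⁻¹ • ((u : GL (Fin 3) K) : Matrix (Fin 3) (Fin 3) K) + 1)⁻¹)
  rw [← hadd, ← hsub, Matrix.det_units_conj, Matrix.det_units_conj]

/-- **The chart factor is CONTINUOUS on the window** (inverse window continuous ★ §1, `det`, `normAbs`, division by a non-vanishing `ℝ≥0` function, `√`).
[cite: PlatonovRapinchuk1994, §3.3] -/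
theorem continuousOn_cc (h2 : (2 : K) ≠ 0) (hJ : IsUnit J.det) {z : K} (hz1 : σ z * z = 1) :
    ContinuousOn (fun u : ↥(unitaryGroupOfForm σ J) => NNReal.sqrt (NNReal.sqrt ((normAbs K 2) ^ 6 / (normAbs K ((1 - ((z⁻¹ • ((u : GL (Fin 3) K) : Matrix (Fin 3) (Fin 3) K) - 1) * (z⁻¹ • ((u : GL (Fin 3) K) : Matrix (Fin 3) (Fin 3) K) + 1)⁻¹)).det * (1 + ((z⁻¹ • ((u : GL (Fin 3) K) : Matrix (Fin 3) (Fin 3) K) - 1) * (z⁻¹ • ((u : GL (Fin 3) K) : Matrix (Fin 3) (Fin 3) K) + 1)⁻¹)).det)) ^ 2)))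
      {u : ↥(unitaryGroupOfForm σ J) | IsUnit (z⁻¹ • ((u : GL (Fin 3) K) : Matrix (Fin 3) (Fin 3) K) + 1).det} := by
  have hψ := continuousOn_psi σ (J := J) z
  have hden : ContinuousOn (fun u : ↥(unitaryGroupOfForm σ J) => normAbs K ((1 - ((z⁻¹ • ((u : GL (Fin 3) K) : Matrix (Fin 3) (Fin 3) K) - 1) * (z⁻¹ • ((u : GL (Fin 3) K) : Matrix (Fin 3) (Fin 3) K) + 1)⁻¹)).det * (1 + ((z⁻¹ • ((u : GL (Fin 3) K) : Matrix (Fin 3) (Fin 3) K) - 1) * (z⁻¹ • ((u : GL (Fin 3) K) : Matrix (Fin 3) (Fin 3) K) + 1)⁻¹)).det))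
      {u : ↥(unitaryGroupOfForm σ J) | IsUnit (z⁻¹ • ((u : GL (Fin 3) K) : Matrix (Fin 3) (Fin 3) K) + 1).det} :=
    LocalFieldHaar.continuous_normAbs.comp_continuousOn
      (((continuous_const.sub continuous_id).matrix_det.comp_continuousOn hψ).mul
        ((continuous_const.add continuous_id).matrix_det.comp_continuousOn hψ))
  have hne : ∀ u ∈ {u : ↥(unitaryGroupOfForm σ J) | IsUnit (z⁻¹ • ((u : GL (Fin 3) K) : Matrix (Fin 3) (Fin 3) K) + 1).det},
      normAbs K ((1 - ((z⁻¹ • ((u : GL (Fin 3) K) : Matrix (Fin 3) (Fin 3) K) - 1) * (z⁻¹ • ((u : GL (Fin 3) K) : Matrix (Fin 3) (Fin 3) K) + 1)⁻¹)).det * (1 + ((z⁻¹ • ((u : GL (Fin 3) K) : Matrix (Fin 3) (Fin 3) K) - 1) * (z⁻¹ • ((u : GL (Fin 3) K) : Matrix (Fin 3) (Fin 3) K) + 1)⁻¹)).det) ^ 2 ≠ 0 := by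
    intro u hu
    obtain ⟨-, hm, hp, -⟩ := window_data σ h2 hJ hz1 u hu
    exact pow_ne_zero _ ((map_ne_zero (normAbs K)).2 (mul_ne_zero hm.ne_zero hp.ne_zero))
  exact NNReal.continuous_sqrt.comp_continuousOn (NNReal.continuous_sqrt.comp_continuousOn
    (continuousOn_const.div (hden.pow 2) hne))

/-- **THE TOKEN ON THE WINDOW**: for `u ∈ O_z`, `T(u) = cc_z(u) · |discr χ_X|^{1∕4}` with `X = (z⁻¹u − 1)(z⁻¹u + 1)⁻¹` — ★ E5a `coe_sqrt_sqrt_weylRatio_smul_cayley` read at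
`u = z · c(X)` (`window_data`), `T` the group cand's `√√(|discr χ_u| · |det u|⁻²)`. [cite: Rogawski1990, §7.3 p. 97] [cite: PlatonovRapinchuk1994, §3.3] -/
theorem token_eq_cc_mul (h2 : (2 : K) ≠ 0) (hJ : IsUnit J.det) {z : K} (hz1 : σ z * z = 1) (u : ↥(unitaryGroupOfForm σ J))
    (hu : IsUnit (z⁻¹ • ((u : GL (Fin 3) K) : Matrix (Fin 3) (Fin 3) K) + 1).det) :
    ((NNReal.sqrt (NNReal.sqrt (normAbs K ((u : GL (Fin 3) K) : Matrix (Fin 3) (Fin 3) K).charpoly.discr * (normAbs K ((u : GL (Fin 3) K) : Matrix (Fin 3) (Fin 3) K).det ^ 2)⁻¹)) : ℝ≥0) : ℝ≥0∞) =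
      ((NNReal.sqrt (NNReal.sqrt ((normAbs K 2) ^ 6 / (normAbs K ((1 - ((z⁻¹ • ((u : GL (Fin 3) K) : Matrix (Fin 3) (Fin 3) K) - 1) * (z⁻¹ • ((u : GL (Fin 3) K) : Matrix (Fin 3) (Fin 3) K) + 1)⁻¹)).det * (1 + ((z⁻¹ • ((u : GL (Fin 3) K) : Matrix (Fin 3) (Fin 3) K) - 1) * (z⁻¹ • ((u : GL (Fin 3) K) : Matrix (Fin 3) (Fin 3) K) + 1)⁻¹)).det)) ^ 2)) : ℝ≥0) : ℝ≥0∞) * ((normAbs K ((z⁻¹ • ((u : GL (Fin 3) K) : Matrix (Fin 3) (Fin 3) K) - 1) * (z⁻¹ • ((u : GL (Fin 3) K) : Matrix (Fin 3) (Fin 3) K) + 1)⁻¹).charpoly.discr : ℝ≥0) : ℝ≥0∞) ^ (1 / 4 : ℝ) := by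
  have hz0 : z ≠ 0 := by
    rintro rfl
    rw [mul_zero] at hz1
    exact zero_ne_one hz1
  obtain ⟨-, hm, hp, hu_eq⟩ := window_data σ h2 hJ hz1 u hu
  conv_lhs => rw [hu_eq]
  rw [coe_sqrt_sqrt_weylRatio_smul_cayley h2 hz0 hm hp, coe_sqrt_sqrt_eq_rpow]

end TranslatedWindow

end Summit.HodgeConjecture.HodgeConjecture.Cruxes.H413.K2E3HC14EllCayleyWindows

end
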